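import Summits.QuantumFields.BalabanUV.T4Continuum.Support.ChainEndFix
import Summits.QuantumFields.BalabanUV.T4Continuum.Support.ChainEndTransport
import HarnessLib

/-!
# T⁴ programme, node NE3 — the kinematic refinement lemma, leaf R2 READ ON BAŁABAN'S MATRIX CONFIGURATIONS:
# an approximate refinement becomes an EXACT one (glue R0, first half)

NE3 prover lineage P1, gen 17 (cell `pub-balaban`, unit `b2b-balaban-t4-ne3-p1`, row NE3 OWNER); skeleton
SKELETON-NE3-P1.md v1.2 §3 rows R2∕R0; crew register `t4/formal/NE3/LEAVES.md` row R0 (owner).  This file is the ONE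
theorem of R0's first half: `ChainEndFix.rescale_bavg_modify_corrField_eq` (the exact chain-end fix, any non-trivial
C⋆-algebra; this lineage) + `ChainEndTransport.modify_regularData` (the bond-local transport of unitarity ∕ periodicity ∕
small-field radius ∕ pointwise flux gradient through `modify`, crew leaf-04 p210879, built on leaf-09's toolkit
`GaugeFieldPerturbation` p210483) + `ChainEndFix.corrField_shift` (periodic data ⇒ periodic correction) ⇒

**`exists_exact_refinement`**: `L ≥ 1`; `W` a `U(N)`-valued `(L·M)`-periodic configuration of `ℤ^d` with
`|W(∂p) − 1| ≤ a`, `512(d+1)(d+4)L²a ≤ 1`, covariant flux gradients `≤ c_W`; `U` a `U(N)`-valued `M`-periodic coarse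
configuration with MISMATCH `‖U(z,κ) − rescale L (bavg L W) (z,κ)‖ ≤ δ` everywhere; `4(16(d+1)(d+4)L²a + 2δ/g) ≤ g`
(`g = gap d L = L^{1−d}`) and `a + 8δ/g ≤ 1/2`.  THEN some `U(N)`-valued `(L·M)`-periodic `W′` has
`rescale L (bavg L W′) = U` EXACTLY, `|W′(∂p) − 1| ≤ a + 8δ/g`, covariant flux gradients `≤ c_W + 36δ/g`.
The C⋆-structure of `M_N(ℂ)` is assembled inside the proof; no statement mentions it.

HONEST FRAMING.  A composition of landed modules; no estimate of the cell, no conditional (`BetaPertH`, (B), (B^μ))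
used or hidden; nothing bears on infinite volume, a mass gap, or the Clay problem; **NE3 is NOT proved** (leaf R1 of
the kinematic lemma — the approximate covariant refinement — remains).  No `sorry`, no axioms beyond Mathlib's.
PLACEMENT: `Summits/QuantumFields/BalabanUV/`; imports `ChainEndFix` (owner, p210675) and `ChainEndTransport`
(crew leaf-04, p210879) BY NAME, restates nothing of them.
-/

set_option autoImplicit false

open scoped BigOperators Matrix Matrix.Norms.L2Operator
open NormedSpace

namespace Summit.QuantumFields.BalabanUV.T4Continuum.ChainEndExact

open Literature.MathematicalPhysics.QuantumFieldTheory.Balaban1983to89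
open B7Prop1Explicit B7Prop2Explicit UnitaryModel
open T4AveragingDeficitWall (IsUnitaryCfg SmallField flux covGrad)
open T4AveragingDeficitWallBoundary (IsPeriodicCfg)
open ChainEndFix ChainEndTransport

noncomputable section

variable {d : ℕ} {n : Type*} [Fintype n] [DecidableEq n] [Nonempty n]

/-- **EXACTNESS IS FREE, FOR BAŁABAN'S CONFIGURATIONS** (leaf R2 of the kinematic lemma read on the tree's objects;
the socket through which an APPROXIMATE covariant refinement — leaf R1 — becomes the EXACT one of
`MinimalActionRefine.SmoothRefine`).  See the module header for the statement in words; `W′` is the chain-end fix of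
`W` by the canonical correction field `ChainEndFix.corrField L W U (2δ/g)` (`‖c − 1‖ ≤ 2δ/g`). [folklore] -/
theorem exists_exact_refinement {L : ℕ} (hL : 1 ≤ L) {W U : Site d → Fin d → (Matrix n n ℂ)ˣ} (hW : IsUnitaryCfg W)
    (hU : IsUnitaryCfg U) {a δ cW : ℝ} (ha : 0 ≤ a) (hδ : 0 ≤ δ)
    (hsmall : 512 * (d + 1) * (d + 4) * (L : ℝ) ^ 2 * a ≤ 1) (hWa : SmallField W a)
    (hgrad : ∀ (x : Site d) (κ : Fin d) (π : T4AveragingDeficitWall.Plane d), ‖covGrad W (flux W) x κ π‖ ≤ cW)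
    (hmis : ∀ (z : Site d) (κ : Fin d),
      ‖((U z κ : (Matrix n n ℂ)ˣ) : Matrix n n ℂ) - ((rescale L (bavg L W) z κ : (Matrix n n ℂ)ˣ) : Matrix n n ℂ)‖ ≤ δ)
    (hgap : 4 * (2 * (8 * (d + 1) * (d + 4) * (L : ℝ) ^ 2 * a) + 2 * δ / gap d L) ≤ gap d L)
    (hhalf : a + 8 * δ / gap d L ≤ 1 / 2) {M : ℕ} (hWP : IsPeriodicCfg W ((L * M : ℕ) : ℤ))
    (hUP : IsPeriodicCfg U (M : ℤ)) :
    ∃ W' : Site d → Fin d → (Matrix n n ℂ)ˣ, IsUnitaryCfg W' ∧ IsPeriodicCfg W' ((L * M : ℕ) : ℤ) ∧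
      rescale L (bavg L W') = U ∧ SmallField W' (a + 8 * δ / gap d L) ∧
      ∀ (x : Site d) (κ : Fin d) (π : T4AveragingDeficitWall.Plane d),
        ‖covGrad W' (flux W') x κ π‖ ≤ cW + 36 * δ / gap d L := by
  letI : CStarAlgebra (Matrix n n ℂ) := {}
  have hg := (gap_pos (d := d) hL).1
  set ρ : ℝ := 2 * δ / gap d L with hρdef
  have hρ : 0 ≤ ρ := div_nonneg (by positivity) hg.le
  have hmis' : ∀ (z : Site d) (κ : Fin d), ‖((U z κ : (Matrix n n ℂ)ˣ) : Matrix n n ℂ)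
      - ((bavg L W ((L : ℤ) • z) κ : (Matrix n n ℂ)ˣ) : Matrix n n ℂ)‖ ≤ δ :=
    fun z κ => by simpa [rescale_apply] using hmis z κ
  obtain ⟨hcu, hcρ, hexact⟩ := rescale_bavg_modify_corrField_eq hL hW hU ha hδ hsmall hWa hmis' hgap
  set c := corrField L W U ρ with hcdef
  -- the correction field is `M`-periodic: it is a FUNCTION of `M`-periodic local data
  have hcp : IsPeriodicCfg c (M : ℤ) := fun z ν μ => by
    have hWt : ∀ (x : Site d) (μ' : Fin d), W (x + (L : ℤ) • ((M : ℤ) • e ν)) μ' = W x μ' := fun x μ' => by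
      rw [smul_smul, show (L : ℤ) * (M : ℤ) = ((L * M : ℕ) : ℤ) by push_cast; ring]; exact hWP x ν μ'
    exact corrField_shift ρ hWt (fun z' κ' => hUP z' ν κ') z μ
  have har : a + 4 * ρ ≤ 1 / 2 := by
    have : a + 4 * ρ = a + 8 * δ / gap d L := by rw [hρdef]; ring
    rw [this]; exact hhalf
  obtain ⟨hu', hp', hs', hg'⟩ := modify_regularData L hL hW hWP hcu hcp hρ hcρ hWa har hgrad
  refine ⟨ChainEndWords.modify L W c, hu', hp', hexact, ?_, fun x κ π => (hg' x κ π).trans (le_of_eq ?_)⟩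
  · have : a + 4 * ρ = a + 8 * δ / gap d L := by rw [hρdef]; ring
    rwa [this] at hs'
  · rw [hρdef]; ring

end

end Summit.QuantumFields.BalabanUV.T4Continuum.ChainEndExact
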